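import Literature.Analysis.Pluripotential.Plurisubharmonic
import HarnessLib

/-!
# Harmonic measure (Perron form) and the two-constant theorem

Topic `Literature/Analysis/Potential`, namespace `Literature.Analysis.Potential`; answers the
definition request `defn-harmonicMeasure` (route `QuantumAdvantage/NeedleThreshold`, support item
`MomentWall`: the two-constant estimate for `log |p|` on the unit disc slit along `[b, 1]`).

Source: T. Ransford, *Potential Theory in the Complex Plane* (1995), §4.1 (Def. 4.1.1, the Perron
function `H_D φ`), §4.3 (Def. 4.3.1 harmonic measure, Thm. 4.3.3 `ω_D(z, B) = H_D 1_B(z)`,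
Thm. 4.3.7 the two-constant theorem). [Ransford1995]

## The objects (REAL definitions)

* `perronFamily D φ φi` — Ransford's family `𝓤` of Def. 4.1.1 for an open set `D ⊆ ℂ`: the
  subharmonic functions `u` on `D` (the tree's `Literature.Analysis.Pluripotential.IsSubharmonicOn`,
  Hörmander's mean-value form, values in `[-∞, +∞)`; equivalent to Ransford's Def. 2.2.1 by his
  Thm. 2.4.1 / Cor. 2.4.2) with `limsup_{w → ζ, w ∈ D} u(w) ≤ φ(ζ)` at every finite boundary point
  `ζ ∈ ∂D` AND `limsup_{w → ∞, w ∈ D} u(w) ≤ φi`. Ransford works in the sphere `ℂ_∞`, where `∞`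
  is a boundary point of every unbounded `D ⊂ ℂ` and carries boundary data like any other point
  ("the validity of part (b) depends on our convention that `∞ ∈ ∂D` whenever `D` is unbounded",
  after Thm. 2.3.1); over `ℂ` we render the datum at `∞` as the separate argument `φi` and the
  approach to `∞` inside `D` as the filter `cocompact ℂ ⊓ 𝓟 D`. For bounded `D` that filter is `⊥`
  and the condition is vacuous (`mem_perronFamily_iff_of_isBounded`).
* `perron D φ φi z = ⨆ u ∈ 𝓤, u z` — the Perron function `H_D φ (z)` (Def. 4.1.1), an element of
  `[-∞, +∞]` (a `⨆` in the complete lattice `EReal`, so no side conditions). For bounded data it is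
  real-valued on `D` (Thm. 4.1.2, by the maximum principle; not proved here); at `z ∉ D` the values
  `u z` are unconstrained and `perron … z = ⊤` (junk).
* `harmonicMeasure D z B` — the harmonic measure `ω_D(z, B) := H_D 1_B (z)` of `B ⊆ ∂D` at
  `z ∈ D`, as a real number in `[0, 1]`: boundary datum `1` on `B`, `0` on `∂D ∖ B` and `0` at
  `∞` (for unbounded `D` the boundary point `∞` counts as OUTSIDE `B`; `{∞}` is polar, so this
  loses nothing when `∂D` is non-polar, Thm. 4.3.6). By Ransford's Thm. 4.3.3, for a domain
  `D ⊂ ℂ_∞` with non-polar boundary — in particular every bounded domain of `ℂ` — this IS the value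
  at `B` of the unique harmonic measure `ω_D(z, ·)` of Def. 4.3.1/Thm. 4.3.2 (a Borel probability
  measure on `∂D`); when `∂D` is polar Def. 4.3.1 does not single out a measure (Exercise 4.3.1)
  and we simply keep the Perron value. Only `B ∩ ∂D` matters (`harmonicMeasure_inter_frontier`).
  The real number is `(min (H_D 1_B (z)) 1).toReal`: since `0 ≤ H_D 1_B ≤ 1` on `D` ((4.1) of
  Thm. 4.1.2: `0 ∈ 𝓤`, and every `u ∈ 𝓤` is `≤ 1` by the maximum principle) the `min` is a no-op
  at every `z ∈ D`; it only replaces the junk `⊤` at `z ∉ D` by `1` and makes `0 ≤ ω ≤ 1`,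
  monotonicity in `B` and the lower-bound principle `le_harmonicMeasure_of_mem` ("spot a member of
  the Perron family", the way Table 4.1 is used) available without the maximum principle.

## The named fact

* `TwoConstantTheorem` — Ransford's Thm. 4.3.7 for BOUNDED DOMAINS of `ℂ` (open, connected,
  bounded `D`; a bounded domain is a proper subdomain of `ℂ_∞` whose boundary is non-polar, since a
  closed polar set is totally disconnected (Cor. 3.6.4) and cannot separate `D` from the exterior
  of a large disc, so Ransford's hypotheses hold and his `ω_D` is ours by Thm. 4.3.3): if `u` is
  subharmonic on `D`, `u ≤ M` on `D` and `limsup_{z → ζ} u(z) ≤ m` for every `ζ` in a Borel set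
  `B ⊆ ∂D`, then `u(z) ≤ m ω_D(z, B) + M (1 - ω_D(z, B))` on `D`. Stated as a `def … : Prop`
  (D-0014); users take `(h : TwoConstantTheorem)`.

## What is NOT here

Thm. 4.1.2 (harmonicity of `H_D φ`), regularity and barriers (§4.2), existence/uniqueness of
harmonic measure as a measure and `H_D = P_D` (Thms. 4.3.2–4.3.4), the subordination principle and
its corollaries (Thm. 4.3.8, Cor. 4.3.9), the Beurling/Carleman–Milloux estimates (§4.5), the
maximum principle itself (Thm. 2.3.1). Mathlib (v4.32) has the Poisson kernel of the disc,
harmonic functions on inner-product spaces and `Real.circleAverage`, but no subharmonic functions,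
Perron families or harmonic measure (searched `ubharmonic`, `erron`, `armonicMeasure`).

## References

* [Ransford1995] T. Ransford, Potential Theory in the Complex Plane, LMS Student Texts 28, CUP
  (1995): Def. 2.2.1, Thm. 2.3.1, Thm. 2.4.1, Cor. 2.4.2, Cor. 3.6.4, Def. 4.1.1, Thm. 4.1.2,
  Def. 4.3.1, Thms. 4.3.2, 4.3.3, 4.3.4, 4.3.6, 4.3.7 (READ, pp. 28–35, 85–101 of the book).
* [HormanderSCV1973] L. Hörmander, An introduction to complex analysis in several variables,
  Thm. 1.6.3 (the mean-value form of subharmonicity used by `IsSubharmonicOn`).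
-/

noncomputable section

open _root_.Filter _root_.Set _root_.Metric _root_.Bornology
open scoped _root_.Topology
open Literature.Analysis.Pluripotential

namespace Literature.Analysis.Potential

variable {D : Set ℂ} {φ ψ : ℂ → EReal} {φi ψi : EReal} {u : ℂ → EReal} {z : ℂ}

/-! ### The Perron family and the Perron function -/

/-- The **Perron family** `𝓤 = 𝓤(D, φ, φi)` of an open set `D ⊆ ℂ` with boundary data `φ` on the
finite boundary `∂D` and `φi` at the point at infinity: all functions `u : ℂ → [-∞, +∞]` that are
subharmonic on `D` and satisfy `limsup_{w → ζ, w ∈ D} u(w) ≤ φ(ζ)` for every `ζ ∈ ∂D` and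
`limsup_{w → ∞, w ∈ D} u(w) ≤ φi` (vacuous for bounded `D`). Values of `φ` off `∂D` and of `u` off
`D` are irrelevant. [cite: Ransford1995, Def. 4.1.1] -/
def perronFamily (D : Set ℂ) (φ : ℂ → EReal) (φi : EReal) : Set (ℂ → EReal) :=
  {u | IsSubharmonicOn u D ∧ (∀ ζ ∈ frontier D, limsup u (𝓝[D] ζ) ≤ φ ζ) ∧
    limsup u (cocompact ℂ ⊓ 𝓟 D) ≤ φi}

/-- The **Perron function** `H_D φ (z) = sup_{u ∈ 𝓤} u(z) ∈ [-∞, +∞]` of the open set `D ⊆ ℂ` with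
boundary data `φ` on `∂D` and `φi` at `∞` (the supremum is taken in the complete lattice `EReal`;
for bounded `φ` and `z ∈ D` it is a real number by the maximum principle, Thm. 4.1.2; for `z ∉ D`
it is the junk value `⊤`). [cite: Ransford1995, Def. 4.1.1] -/
def perron (D : Set ℂ) (φ : ℂ → EReal) (φi : EReal) (z : ℂ) : EReal :=
  ⨆ u ∈ perronFamily D φ φi, u z

/-- Unfolding of `perronFamily`. [cite: Ransford1995, Def. 4.1.1] -/
theorem mem_perronFamily_iff : u ∈ perronFamily D φ φi ↔
    IsSubharmonicOn u D ∧ (∀ ζ ∈ frontier D, limsup u (𝓝[D] ζ) ≤ φ ζ) ∧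
      limsup u (cocompact ℂ ⊓ 𝓟 D) ≤ φi := Iff.rfl

/-- Unfolding of `perron`. [cite: Ransford1995, Def. 4.1.1] -/
theorem perron_def (D : Set ℂ) (φ : ℂ → EReal) (φi : EReal) (z : ℂ) :
    perron D φ φi z = ⨆ u ∈ perronFamily D φ φi, u z := rfl

/-- Every member of the Perron family lies below the Perron function: `u ≤ H_D φ`.
[cite: Ransford1995, Def. 4.1.1] -/
theorem le_perron_of_mem (hu : u ∈ perronFamily D φ φi) (z : ℂ) : u z ≤ perron D φ φi z :=
  le_iSup₂ (f := fun (v : ℂ → EReal) (_ : v ∈ perronFamily D φ φi) ↦ v z) u hu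

/-- `H_D φ (z) ≤ a` iff `u(z) ≤ a` for every `u` in the Perron family. [cite: Ransford1995, Def. 4.1.1] -/
theorem perron_le_iff {a : EReal} : perron D φ φi z ≤ a ↔ ∀ u ∈ perronFamily D φ φi, u z ≤ a :=
  iSup₂_le_iff

/-- The Perron family grows with the boundary data (only the data on `∂D` and at `∞` matter).
[cite: Ransford1995, Def. 4.1.1] -/
theorem perronFamily_mono (hφ : ∀ ζ ∈ frontier D, φ ζ ≤ ψ ζ) (hφi : φi ≤ ψi) :
    perronFamily D φ φi ⊆ perronFamily D ψ ψi := fun _u hu ↦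
  ⟨hu.1, fun ζ hζ ↦ (hu.2.1 ζ hζ).trans (hφ ζ hζ), hu.2.2.trans hφi⟩

/-- The Perron function is monotone in the boundary data: `φ ≤ ψ` on `∂D` and `φi ≤ ψi` give
`H_D φ ≤ H_D ψ`. [cite: Ransford1995, Def. 4.1.1] -/
theorem perron_mono (hφ : ∀ ζ ∈ frontier D, φ ζ ≤ ψ ζ) (hφi : φi ≤ ψi) (z : ℂ) :
    perron D φ φi z ≤ perron D ψ ψi z :=
  perron_le_iff.2 fun _u hu ↦ le_perron_of_mem (perronFamily_mono hφ hφi hu) z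

/-- The Perron function only depends on the boundary data on `∂D` (and at `∞`).
[cite: Ransford1995, Def. 4.1.1] -/
theorem perron_congr (hφ : ∀ ζ ∈ frontier D, φ ζ = ψ ζ) (z : ℂ) :
    perron D φ φi z = perron D ψ φi z :=
  le_antisymm (perron_mono (fun ζ hζ ↦ (hφ ζ hζ).le) le_rfl z)
    (perron_mono (fun ζ hζ ↦ (hφ ζ hζ).ge) le_rfl z)

/-- For a bounded set `D` no point of `D` is close to `∞`: the filter `cocompact ℂ ⊓ 𝓟 D` of
"approach to `∞` inside `D`" is trivial. [folklore] -/
theorem cocompact_inf_principal_eq_bot (hD : IsBounded D) : cocompact ℂ ⊓ 𝓟 D = ⊥ := by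
  rw [inf_principal_eq_bot, Filter.mem_cocompact]
  exact ⟨closure D, hD.isCompact_closure, compl_subset_compl.2 subset_closure⟩

/-- For bounded `D` the condition at `∞` in the Perron family is vacuous.
[cite: Ransford1995, Def. 4.1.1] -/
theorem mem_perronFamily_iff_of_isBounded (hD : IsBounded D) : u ∈ perronFamily D φ φi ↔
    IsSubharmonicOn u D ∧ ∀ ζ ∈ frontier D, limsup u (𝓝[D] ζ) ≤ φ ζ := by
  rw [mem_perronFamily_iff, cocompact_inf_principal_eq_bot hD, limsup_bot]
  simp

/-- Membership in the Perron family of a bounded `D`: subharmonic on `D` with the right boundary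
`limsup`s. [cite: Ransford1995, Def. 4.1.1] -/
theorem mem_perronFamily_of_isBounded (hD : IsBounded D) (hu : IsSubharmonicOn u D)
    (hb : ∀ ζ ∈ frontier D, limsup u (𝓝[D] ζ) ≤ φ ζ) : u ∈ perronFamily D φ φi :=
  (mem_perronFamily_iff_of_isBounded hD).2 ⟨hu, hb⟩

/-- A real constant `c` below the data (`c ≤ φ` on `∂D`, `c ≤ φi`) belongs to the Perron family
("certainly `-M ∈ 𝓤`"). [cite: Ransford1995, proof of Thm. 4.1.2] -/
theorem const_mem_perronFamily {c : ℝ} (hφ : ∀ ζ ∈ frontier D, (c : EReal) ≤ φ ζ)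
    (hφi : (c : EReal) ≤ φi) : (fun _ ↦ (c : EReal)) ∈ perronFamily D φ φi := by
  refine ⟨isSubharmonicOn_const c D, fun ζ hζ ↦ ?_, ?_⟩
  · exact (limsup_le_iSup.trans (iSup_const (ι := ℂ)).le).trans (hφ ζ hζ)
  · exact (limsup_le_iSup.trans (iSup_const (ι := ℂ)).le).trans hφi

/-- A real constant below the data is below the Perron function: `c ≤ H_D φ`.
[cite: Ransford1995, Thm. 4.1.2 (4.1)] -/
theorem coe_le_perron {c : ℝ} (hφ : ∀ ζ ∈ frontier D, (c : EReal) ≤ φ ζ) (hφi : (c : EReal) ≤ φi)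
    (z : ℂ) : (c : EReal) ≤ perron D φ φi z :=
  le_perron_of_mem (const_mem_perronFamily hφ hφi) z

/-! ### Harmonic measure -/

/-- The **harmonic measure** `ω_D(z, B)` of `B ⊆ ∂D` for the open set `D ⊆ ℂ` at `z ∈ D`: the value
at `z` of the Perron function of `D` with boundary data `1_B` on `∂D` and `0` at `∞`, i.e.
`ω_D(z, B) = H_D 1_B (z)` — for a domain of `ℂ_∞` with non-polar boundary (e.g. any bounded domain
of `ℂ`) this is Ransford's harmonic measure evaluated at `B` (Thm. 4.3.3); as a real number
`(min (H_D 1_B (z)) 1).toReal ∈ [0, 1]` (the `min` is a no-op for `z ∈ D`, where `0 ≤ H_D 1_B ≤ 1`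
by (4.1); junk value `1` for `z ∉ D`). Only `B ∩ ∂D` matters; for unbounded `D` the boundary point
`∞` counts as outside `B`. [cite: Ransford1995, Def. 4.3.1 and Thm. 4.3.3] -/
def harmonicMeasure (D : Set ℂ) (z : ℂ) (B : Set ℂ) : ℝ :=
  (min (perron D (B.indicator 1) 0 z) 1).toReal

/-- Unfolding of `harmonicMeasure`. [cite: Ransford1995, Thm. 4.3.3] -/
theorem harmonicMeasure_def (D : Set ℂ) (z : ℂ) (B : Set ℂ) :
    harmonicMeasure D z B = (min (perron D (B.indicator 1) 0 z) 1).toReal := rfl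

/-- `0 ≤ H_D 1_B`: the zero function belongs to the Perron family of the indicator data.
[cite: Ransford1995, Thm. 4.1.2 (4.1)] -/
theorem perron_indicator_nonneg (D : Set ℂ) (z : ℂ) (B : Set ℂ) :
    0 ≤ perron D (B.indicator 1) 0 z := by
  have h := coe_le_perron (D := D) (φ := B.indicator 1) (φi := 0) (c := 0)
    (fun ζ _ ↦ ?_) (by simp) z
  · simpa using h
  · simp only [EReal.coe_zero]
    by_cases hζ : ζ ∈ B <;> simp [hζ]

/-- `0 ≤ ω_D(z, B)`. [cite: Ransford1995, Def. 4.3.1] -/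
theorem harmonicMeasure_nonneg (D : Set ℂ) (z : ℂ) (B : Set ℂ) : 0 ≤ harmonicMeasure D z B := by
  rw [harmonicMeasure_def]
  exact EReal.toReal_nonneg (le_min (perron_indicator_nonneg D z B) zero_le_one)

/-- `ω_D(z, B) ≤ 1`. [cite: Ransford1995, Def. 4.3.1] -/
theorem harmonicMeasure_le_one (D : Set ℂ) (z : ℂ) (B : Set ℂ) : harmonicMeasure D z B ≤ 1 := by
  rw [harmonicMeasure_def]
  have h1 : min (perron D (B.indicator 1) 0 z) 1 ≤ ((1 : ℝ) : EReal) := min_le_right _ _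
  have h0 : ((0 : ℝ) : EReal) ≤ min (perron D (B.indicator 1) 0 z) 1 := by
    simpa using le_min (perron_indicator_nonneg D z B) zero_le_one
  have := EReal.toReal_le_toReal h1 (ne_bot_of_le_ne_bot (EReal.coe_ne_bot 0) h0)
    (EReal.coe_ne_top 1)
  simpa using this

/-- Harmonic measure as a real number in `[0, 1]` is order-preserving in the Perron value: the
comparison lemma behind monotonicity and lower bounds. [folklore] -/
theorem harmonicMeasure_mono_of_perron_le {D D' : Set ℂ} {z z' : ℂ} {B B' : Set ℂ}
    (h : perron D (B.indicator 1) 0 z ≤ perron D' (B'.indicator 1) 0 z') :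
    harmonicMeasure D z B ≤ harmonicMeasure D' z' B' := by
  rw [harmonicMeasure_def, harmonicMeasure_def]
  refine EReal.toReal_le_toReal (min_le_min_right _ h) ?_ ?_
  · exact ne_bot_of_le_ne_bot (by simp) (le_min (perron_indicator_nonneg D z B) zero_le_one)
  · exact ne_top_of_le_ne_top (EReal.coe_ne_top 1) (min_le_right _ _)

/-- Harmonic measure is monotone in the boundary set: `B ⊆ B'` gives `ω_D(z, B) ≤ ω_D(z, B')`.
[cite: Ransford1995, Def. 4.3.1 (a)] -/
theorem harmonicMeasure_mono {B B' : Set ℂ} (h : B ⊆ B') (D : Set ℂ) (z : ℂ) :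
    harmonicMeasure D z B ≤ harmonicMeasure D z B' :=
  harmonicMeasure_mono_of_perron_le (perron_mono (fun ζ _ ↦
    Set.indicator_le_indicator_of_subset h (fun _ ↦ zero_le_one) ζ) le_rfl z)

/-- Only the part of `B` on the boundary matters: `ω_D(z, B ∩ ∂D) = ω_D(z, B)`.
[cite: Ransford1995, Def. 4.3.1] -/
theorem harmonicMeasure_inter_frontier (D : Set ℂ) (z : ℂ) (B : Set ℂ) :
    harmonicMeasure D z (B ∩ frontier D) = harmonicMeasure D z B := by
  rw [harmonicMeasure_def, harmonicMeasure_def, perron_congr (ψ := B.indicator 1)]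
  intro ζ hζ
  by_cases hB : ζ ∈ B <;> simp [hB, hζ]

/-- **Lower bounds by spotting a member of the Perron family** (how Table 4.1 is used): if `v` is
subharmonic on `D` with `limsup_{w → ζ} v(w) ≤ 1_B(ζ)` on `∂D` (and `≤ 0` at `∞`), then
`v(z) ≤ ω_D(z, B)` in the sense that every real `x ≤ min (v z) 1` is `≤ ω_D(z, B)`.
[cite: Ransford1995, Def. 4.1.1 and Thm. 4.3.4] -/
theorem le_harmonicMeasure_of_mem {v : ℂ → EReal} {B : Set ℂ} {x : ℝ}
    (hv : v ∈ perronFamily D (B.indicator 1) 0) (hx : (x : EReal) ≤ v z) (hx1 : x ≤ 1) :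
    x ≤ harmonicMeasure D z B := by
  rw [harmonicMeasure_def]
  have hle : (x : EReal) ≤ min (perron D (B.indicator 1) 0 z) 1 :=
    le_min (hx.trans (le_perron_of_mem hv z)) (by exact_mod_cast hx1)
  have := EReal.toReal_le_toReal hle (EReal.coe_ne_bot x)
    (ne_top_of_le_ne_top (EReal.coe_ne_top 1) (min_le_right _ _))
  simpa using this

/-! ### The two-constant theorem (named fact) -/

/-- **Two-constant theorem** (Ransford, Thm. 4.3.7), for bounded domains of `ℂ`: let `D ⊆ ℂ` be
open, connected and bounded (hence a proper subdomain of `ℂ_∞` with non-polar boundary), `B` a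
Borel subset of `∂D`, and `u` subharmonic on `D` with `u(z) ≤ M` for `z ∈ D` and
`limsup_{z → ζ} u(z) ≤ m` for `ζ ∈ B`, where `m, M` are real constants. Then
`u(z) ≤ m ω_D(z, B) + M (1 - ω_D(z, B))` for all `z ∈ D`. Printed for domains of `ℂ_∞` with
non-polar boundary; `ω_D` there is the harmonic measure of Def. 4.3.1, which for such domains is
`harmonicMeasure` (Thm. 4.3.3). A named fact (D-0014): users take `(h : TwoConstantTheorem)`.
[cite: Ransford1995, Thm. 4.3.7] -/
def TwoConstantTheorem : Prop :=
  ∀ ⦃D B : Set ℂ⦄ ⦃u : ℂ → EReal⦄ ⦃m M : ℝ⦄, IsOpen D → IsConnected D → IsBounded D →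
    B ⊆ frontier D → MeasurableSet B → IsSubharmonicOn u D → (∀ z ∈ D, u z ≤ M) →
    (∀ ζ ∈ B, limsup u (𝓝[D] ζ) ≤ m) →
    ∀ z ∈ D, u z ≤ ((m * harmonicMeasure D z B + M * (1 - harmonicMeasure D z B) : ℝ) : EReal)

end Literature.Analysis.Potential
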